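import Literature.AlgebraicGeometry.Motives.HodgeThetaSubalgebraUnitary
import Literature.AlgebraicGeometry.Motives.HodgeThetaAnnihilatorTimesNonCMCurve
import Literature.Algebra.Lie.SpecialLinearSimple
import HarnessLib

/-!
# The derived algebra `[𝔥(H), 𝔥(H)]` of a unitary Hodge Lie algebra with `dim [𝔥,𝔥] + 1 = (dim W)²` is SIMPLE: `[𝔥,𝔥] ⊗ ℂ ≅ 𝔰𝔩(W)`
# (the input «`𝔡` simple» of the unitary Lemma (3.4) for Ribet type `(g − 1, 1)` in every dimension)

COR-CM (cell `pub-hodgecm2`, seat `b27` gen 53, count-neutral Mumford–Tate-rank ladder; theorems only, no definition, no named fact; UNCONDITIONAL —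
nothing here uses or asserts HC_CM).  Gen 52ʼs chain `CorCM/MumfordTateRankUnitaryPair{Blocks,…,Count}` (the unitary analogue of Moonen–Zarhinʼs
Lemma (3.4)) is dimension-free; its threefold input «the derived algebra `𝔡 = [Lie Hg(H¹T), Lie Hg(H¹T)]` is simple» came from `dim 𝔡 = 8`
(`Algebra/Lie/SemisimpleDimensionEight`).  HERE the same input in every dimension, abstractly.  SETTING: a polarized `ℚ`-Hodge structure `H` on
`V` (`ψ` a polarization), a Hodge endomorphism `φ` with `φ² = −d` (`d > 0`), `End_Hdg(H) = ℚ + ℚφ`, a root `μ ∈ ℂ` of `−d`, `W = ker(φ_ℂ − μ)`,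
`𝔥 = 𝔥(H)` the Hodge Lie algebra (so `𝔥 ⊆ 𝔲_K(V, ψ)`: its elements commute with `φ` and are `ψ`-skew), `𝔡 = [𝔥, 𝔥]` (the `ℚ`-span of the
commutators).
* `UnitaryDerived.exists_matrix_model` — the COMPRESSION `τ : Z ↦ [P_W Z|_W]` of `End_ℂ(V_ℂ)` to `M_m(ℂ)`, `m = dim W`, in a basis of `W`
  (`P_W = (μ + φ_ℂ)/2μ` the projector onto `W` along `W̄ = ker(φ_ℂ + μ)`): multiplicative against operators preserving `W`, detects `Z|_W = 0`, onto.
* `UnitaryDerived.finrank_eigenspace_eq_add` — `dim W = dim(W ∩ V^{1,0}) + dim(W ∩ V^{0,1})` in weight one (`Θ ∈ 𝔥 ⊗ ℂ` preserves `W`).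
* **`UnitaryDerived.isSimple_of_finrank_eq`** — if `dim_ℚ 𝔡 + 1 = m²` and `m ≥ 2`, the Lie algebra `𝔡` is SIMPLE (Mathlib `LieAlgebra.IsSimple ℚ`,
  for every Lie subalgebra of `𝔤𝔩(V)` with carrier `𝔡`): `τ` is injective on `𝔥 ⊗ ℂ` (`UnitaryTheta.eq_zero_of_forall_mem_eigenspace`: `W`, `W̄`
  are `ψ_ℂ`-isotropic and in duality), carries `𝔡 ⊗ ℂ` into `𝔰𝔩_m(ℂ)` (commutators are traceless), hence ONTO it (`dim_ℂ 𝔡 ⊗ ℂ = dim_ℚ 𝔡 =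
  m² − 1`, `finrank_spanC_eq`); a Lie ideal `I` of `𝔡` spans the Lie ideal `τ(I ⊗ ℂ)` of `𝔰𝔩_m(ℂ)`, which is `0` (then `I = 0`) or `𝔰𝔩_m(ℂ)`
  (then `dim I = dim 𝔡`, `I = 𝔡`) by the SIMPLICITY OF `𝔰𝔩_m` (`Literature/Algebra/Lie/SpecialLinearSimple`, Humphreys §19.2, lit-balabanʼs file,
  reused not restated); `𝔡` is not abelian because `𝔰𝔩_m` is not.  For Ribet type `(g − 1, 1)` the count holds with `m = g`
  (`𝔥 = 𝔲_K(V, ψ)` of dimension `g²`, `𝔥 = ℚφ ⊕ 𝔡`): sequel `CorCM/MumfordTateRankRibetTypeOneData`.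

## References
* [MoonenZarhin1999LowDim] B. Moonen, Yu. G. Zarhin, *Hodge classes on abelian varieties of low dimension*, Math. Ann. 315 (1999), §2 (2.3), §3 (3.1)
  [corpus: paper:arxiv-math_9901113 pp. 5–6]. [cite: MoonenZarhin1999LowDim, §2 (2.3)]
* [Ribet1983] K. A. Ribet, *Hodge classes on certain types of abelian varieties*, Amer. J. Math. 105 (1983), Thm. 3. [cite: Ribet1983, Thm. 3]
* [Gordon1997] B. B. Gordon, *A survey of the Hodge conjecture for abelian varieties*, §6 (proof of Thm. 6.3.3: `MT(A,ℂ) → GL(W′)`). [cite: Gordon1997, §6 (proof of Thm. 6.3.3, p. 19)]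
* [Humphreys1972] J. E. Humphreys, GTM 9 (1972), §19.2 (`A_l` simple). [cite: Humphreys1972, §19.2]
* [Deligne1982HodgeCycles] P. Deligne, LNM 900 (1982), I §3 (proof of Prop. 3.4: rational structures and base change), Prop. 3.6.
  [cite: Deligne1982HodgeCycles, I §3 Prop. 3.6]

Provenance: Literature home (family `hodge`, namespace `Literature.AlgebraicGeometry.HodgeTheory.MumfordTateRank`) of the Summits-side `CorCM/MumfordTateRankRibetTypeOneDerived` (cell `pub-hodgecm2`, COR-CM; all its imports are `Literature/` and Mathlib), which `Literature/` may not import; theorems only, no named fact, no definition. Nothing here bears on `HC_CM`. Lane `lit-hodgefound` (Layer A3: CM types, their Kubota ranks and Galois combinatorics), seat p20.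
-/

noncomputable section

open scoped TensorProduct
open Module

namespace Literature.AlgebraicGeometry.HodgeTheory.MumfordTateRank

namespace UnitaryDerived

open Literature.AlgebraicGeometry.Motives Literature.AlgebraicGeometry.Motives.HodgeStructure

universe u

variable {V : Type u} [AddCommGroup V] [Module ℚ V] [Module.Finite ℚ V] {n : ℤ}

/-! ## §1 The compression to the eigenspace `W` and the simplicity of the derived algebra -/

/-- **The compression to `W = ker(φ_ℂ − μ)` in a basis**: a `ℂ`-linear `τ : End_ℂ(V_ℂ) → M_m(ℂ)` (`m = dim W`), `τ(Z) = [P_W Z|_W]` with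
`P_W = (μ + φ_ℂ)/2μ` the projector onto `W` along `W̄ = ker(φ_ℂ + μ)`, such that `τ(ZZ′) = τ(Z)τ(Z′)` whenever `Z′W ⊆ W`, `τ(Z) = 0` forces
`Z|_W = 0` when `ZW ⊆ W`, and `τ` is onto. [cite: Gordon1997, §6 (proof of Thm. 6.3.3, p. 19)] -/
theorem exists_matrix_model {φ : Module.End ℚ V} {d : ℚ} (hφ2 : φ * φ = -(d • 1)) {μ : ℂ} (hμ : μ ^ 2 = -(d : ℂ)) (hμ0 : μ ≠ 0) :
    ∃ τ : Module.End ℂ (ℂ ⊗[ℚ] V) →ₗ[ℂ]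
        Matrix (Fin (finrank ℂ ↥(End.eigenspace (φ.baseChange ℂ) μ))) (Fin (finrank ℂ ↥(End.eigenspace (φ.baseChange ℂ) μ))) ℂ,
      (∀ Z Z' : Module.End ℂ (ℂ ⊗[ℚ] V), (∀ w ∈ End.eigenspace (φ.baseChange ℂ) μ, Z' w ∈ End.eigenspace (φ.baseChange ℂ) μ) →
          τ (Z * Z') = τ Z * τ Z') ∧
      (∀ Z : Module.End ℂ (ℂ ⊗[ℚ] V), (∀ w ∈ End.eigenspace (φ.baseChange ℂ) μ, Z w ∈ End.eigenspace (φ.baseChange ℂ) μ) →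
          τ Z = 0 → ∀ w ∈ End.eigenspace (φ.baseChange ℂ) μ, Z w = 0) ∧
      Function.Surjective τ := by
  classical
  set W := End.eigenspace (φ.baseChange ℂ) μ with hWdef
  -- the projector onto `W` along `W̄`
  set eW : Module.End ℂ (ℂ ⊗[ℚ] V) := (2 * μ)⁻¹ • (μ • 1 + φ.baseChange ℂ) with heWdef
  have hφφ : ∀ x, φ.baseChange ℂ (φ.baseChange ℂ x) = (μ * μ) • x := fun x => by
    rw [UnitaryTheta.baseChange_baseChange_apply hφ2, ← sq, hμ, neg_smul]
  have heW_mem : ∀ x, eW x ∈ W := fun x => by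
    rw [hWdef, End.mem_eigenspace_iff, heWdef]
    simp only [LinearMap.smul_apply, LinearMap.add_apply, Module.End.one_apply, map_smul, map_add, hφφ]
    module
  have heW_id : ∀ w ∈ W, eW w = w := fun w hw => by
    rw [heWdef, LinearMap.smul_apply, LinearMap.add_apply, LinearMap.smul_apply, Module.End.one_apply, End.mem_eigenspace_iff.1 hw,
      ← two_smul ℂ, smul_smul, smul_smul, mul_assoc, inv_mul_cancel₀ (mul_ne_zero two_ne_zero hμ0), one_smul]
  let P : ℂ ⊗[ℚ] V →ₗ[ℂ] W := LinearMap.codRestrict W eW heW_mem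
  have hP : ∀ x, ((P x : W) : ℂ ⊗[ℚ] V) = eW x := fun x => rfl
  clear_value P
  let b := Module.finBasis ℂ W
  let c : Module.End ℂ (ℂ ⊗[ℚ] V) →ₗ[ℂ] Module.End ℂ W := (LinearMap.llcomp ℂ W (ℂ ⊗[ℚ] V) W P).comp (LinearMap.lcomp ℂ (ℂ ⊗[ℚ] V) W.subtype)
  have hc : ∀ Z (w : W), ((c Z w : W) : ℂ ⊗[ℚ] V) = eW (Z w) := fun Z w => by rw [← hP]; rfl
  clear_value c
  refine ⟨(LinearMap.toMatrix b b).toLinearMap ∘ₗ c, fun Z Z' hZ' => ?_, fun Z hZ h0 w hw => ?_, fun N => ?_⟩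
  · have hcc : c (Z * Z') = c Z * c Z' := LinearMap.ext fun w => Subtype.ext (by
      rw [hc, Module.End.mul_apply, Module.End.mul_apply, hc, hc, heW_id _ (hZ' _ w.2)])
    simp only [LinearMap.comp_apply, LinearEquiv.coe_toLinearMap, hcc, LinearMap.toMatrix_mul]
  · rw [LinearMap.comp_apply, LinearEquiv.coe_toLinearMap, LinearEquiv.map_eq_zero_iff] at h0
    have h := congrArg (fun T : Module.End ℂ W => ((T ⟨w, hw⟩ : W) : ℂ ⊗[ℚ] V)) h0
    simpa only [hc, LinearMap.zero_apply, Submodule.coe_zero, heW_id _ (hZ w hw)] using h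
  · refine ⟨W.subtype ∘ₗ Matrix.toLin b b N ∘ₗ P, ?_⟩
    have hcc : c (W.subtype ∘ₗ Matrix.toLin b b N ∘ₗ P) = Matrix.toLin b b N := LinearMap.ext fun w => Subtype.ext (by
      have hPw : P (w : ℂ ⊗[ℚ] V) = w := Subtype.ext (by rw [hP, heW_id _ w.2])
      rw [hc, LinearMap.comp_apply, LinearMap.comp_apply, hPw, Submodule.subtype_apply, heW_id _ (Matrix.toLin b b N w).2])
    simp only [LinearMap.comp_apply, LinearEquiv.coe_toLinearMap, hcc, LinearMap.toMatrix_toLin]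

variable [HodgeTensorFacts.{u, u}]

/-- **`W = W^{1,0} ⊕ W^{0,1}`, in dimensions**: `dim_ℂ W = dim(W ∩ V^{1,0}) + dim(W ∩ V^{0,1})` for the eigenspace `W = ker(φ_ℂ − μ)` of a Hodge
endomorphism `φ` of an effective weight-one structure (`P = (1 + Θ)/2`, `Q = (1 − Θ)/2` preserve `W` since `Θ ∈ 𝔥 ⊗ ℂ` commutes with `φ_ℂ`).
[cite: Gordon1997, §6 (proof of Thm. 6.3.3, p. 19)] [cite: Deligne1982HodgeCycles, I §3 Prop. 3.6] -/
theorem finrank_eigenspace_eq_add (H : HodgeStructure V n) (hn : n = 1) (heff : H.IsEffective) {φ : Module.End ℚ V} (hφE : φ ∈ H.endAlg)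
    (μ : ℂ) :
    finrank ℂ ↥(End.eigenspace (φ.baseChange ℂ) μ) =
      finrank ℂ ↥(End.eigenspace (φ.baseChange ℂ) μ ⊓ H.piece 1 0) + finrank ℂ ↥(End.eigenspace (φ.baseChange ℂ) μ ⊓ H.piece 0 1) := by
  set W := End.eigenspace (φ.baseChange ℂ) μ with hWdef
  obtain ⟨Θ, hΘ⟩ := exists_hodgeTheta H
  have hΘ𝔤 : Θ ∈ spanC H.hodgeLie := (hodgeLieC_eq_spanC H) ▸ H.mem_hodgeLieC_of_forall_piece hΘ
  have hcomm : ∀ X ∈ H.hodgeLie, ∀ a : H.endAlg, X * (a : Module.End ℚ V) = (a : Module.End ℚ V) * X := fun X hX a =>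
    commute_of_mem_hodgeLie H hX a
  have hΘφ : Θ * φ.baseChange ℂ = φ.baseChange ℂ * Θ := UnitaryTheta.commute_of_mem_spanC H hφE hcomm hΘ𝔤
  obtain ⟨hP, hQ, hΘ10, hΘ01, -⟩ := UnitaryTheta.theta_facts H hn heff hΘ
  have hsup : W ⊓ H.piece 1 0 ⊔ W ⊓ H.piece 0 1 = W := by
    apply le_antisymm (sup_le inf_le_left inf_le_left)
    intro w hw
    have hΘw : Θ w ∈ W := UnitaryTheta.apply_mem_eigenspace_of_commute hΘφ hw
    have hPQ : (2 : ℂ)⁻¹ • (w + Θ w) + (2 : ℂ)⁻¹ • (w - Θ w) = w := by module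
    rw [← hPQ]
    exact Submodule.add_mem_sup ⟨W.smul_mem _ (W.add_mem hw hΘw), hP w⟩ ⟨W.smul_mem _ (W.sub_mem hw hΘw), hQ w⟩
  have hinf : W ⊓ H.piece 1 0 ⊓ (W ⊓ H.piece 0 1) = ⊥ := by
    rw [eq_bot_iff]
    intro x hx
    rw [Submodule.mem_bot]
    have h1 := hΘ10 x hx.1.2
    rw [hΘ01 x hx.2.2, neg_eq_iff_add_eq_zero, ← two_smul ℂ x, smul_eq_zero] at h1
    exact h1.resolve_left (two_ne_zero' ℂ)
  have hsum := Submodule.finrank_sup_add_finrank_inf_eq (W ⊓ H.piece 1 0) (W ⊓ H.piece 0 1)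
  rw [hsup, hinf, finrank_bot, add_zero] at hsum
  exact hsum

set_option maxHeartbeats 800000 in
/-- **The derived algebra `𝔡 = [𝔥(H), 𝔥(H)]` of a unitary Hodge Lie algebra is SIMPLE when `dim_ℚ 𝔡 + 1 = (dim_ℂ W)²`, `dim W ≥ 2`**
(`H` polarized, `φ ∈ End_Hdg` with `φ² = −d`, `End_Hdg = ℚ + ℚφ`, `W = ker(φ_ℂ − μ)`; the count holds for Ribet type `(m, 1)`, where
`𝔥(H) = 𝔲_K(V, ψ)`): the compression `τ` to `W` is injective on `𝔥 ⊗ ℂ` (`UnitaryTheta.eq_zero_of_forall_mem_eigenspace`) and maps `𝔡 ⊗ ℂ`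
ONTO `𝔰𝔩(W)` (traceless commutators; equal dimensions `m² − 1`, `finrank_spanC_eq`); a Lie ideal `I` of `𝔡` spans the Lie ideal `τ(I ⊗ ℂ)` of
`𝔰𝔩_m(ℂ)`, which is `0` (then `I = 0`) or `𝔰𝔩_m(ℂ)` (then `dim I = dim 𝔡`) by the simplicity of `𝔰𝔩_m`; and `𝔡` is not abelian since
`𝔰𝔩_m` is not. [cite: Humphreys1972, §19.2] [cite: MoonenZarhin1999LowDim, §2 (2.3)] [cite: Gordon1997, §6 (proof of Thm. 6.3.3, p. 19)] -/
theorem isSimple_of_finrank_eq (H : HodgeStructure V n) (ψ : H.Polarization) {φ : Module.End ℚ V} (hφE : φ ∈ H.endAlg) {d : ℚ}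
    (hd : 0 < d) (hφ2 : φ * φ = -(d • 1)) (hE : ∀ a ∈ H.endAlg, ∃ x y : ℚ, a = x • 1 + y • φ) {μ : ℂ} (hμ : μ ^ 2 = -(d : ℂ))
    (hW2 : 2 ≤ finrank ℂ ↥(End.eigenspace (φ.baseChange ℂ) μ))
    (hcount : finrank ℚ ↥(Submodule.span ℚ {B | ∃ X ∈ H.hodgeLie, ∃ Y ∈ H.hodgeLie, X * Y - Y * X = B}) + 1 =
      finrank ℂ ↥(End.eigenspace (φ.baseChange ℂ) μ) ^ 2) :
    letI : LieRing (Module.End ℚ V) := LieRing.ofAssociativeRing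
    ∀ 𝔏 : LieSubalgebra ℚ (Module.End ℚ V),
      𝔏.toSubmodule = Submodule.span ℚ {B | ∃ X ∈ H.hodgeLie, ∃ Y ∈ H.hodgeLie, X * Y - Y * X = B} → LieAlgebra.IsSimple ℚ 𝔏 := by
  letI : LieRing (Module.End ℚ V) := LieRing.ofAssociativeRing
  intro 𝔏 h𝔏
  classical
  set 𝔡 := Submodule.span ℚ {B | ∃ X ∈ H.hodgeLie, ∃ Y ∈ H.hodgeLie, X * Y - Y * X = B} with h𝔡def
  set W := End.eigenspace (φ.baseChange ℂ) μ with hWdef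
  set m := finrank ℂ ↥W with hmdef
  have hμ0 : μ ≠ 0 := (UnitaryTheta.conj_eq_neg_of_sq hd hμ).1
  haveI : Nontrivial V := Module.nontrivial_of_finrank_pos (R := ℚ) (by
    have h := Submodule.finrank_le W; rw [Module.finrank_baseChange] at h; omega)
  have h𝔡𝔥 : 𝔡 ≤ H.hodgeLie := Submodule.span_le.2 (by rintro _ ⟨X, hX, Y, hY, rfl⟩; exact H.commutator_mem_hodgeLie hX hY)
  have hcomm : ∀ X ∈ H.hodgeLie, ∀ a : H.endAlg, X * (a : Module.End ℚ V) = (a : Module.End ℚ V) * X := fun X hX a =>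
    commute_of_mem_hodgeLie H hX a
  have hskew := fun X (hX : X ∈ H.hodgeLie) => form_apply_add_eq_zero_of_mem_hodgeLie ψ hX
  have hZφ : ∀ Z ∈ spanC H.hodgeLie, Z * φ.baseChange ℂ = φ.baseChange ℂ * Z := fun Z hZ => UnitaryTheta.commute_of_mem_spanC H hφE hcomm hZ
  have hZW : ∀ Z ∈ spanC H.hodgeLie, ∀ w ∈ W, Z w ∈ W := fun Z hZ w hw => UnitaryTheta.apply_mem_eigenspace_of_commute (hZφ Z hZ) hw
  have hq : ∀ (q : ℚ) (C : Module.End ℚ V), (q • C).baseChange ℂ = (q : ℂ) • C.baseChange ℂ := fun q C =>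
    TensorProduct.AlgebraTensorModule.ext fun z v => by rw [LinearMap.baseChange_tmul, LinearMap.smul_apply, LinearMap.smul_apply,
      LinearMap.baseChange_tmul, TensorProduct.smul_tmul', ← TensorProduct.smul_tmul, Rat.smul_def, smul_eq_mul]
  obtain ⟨τ, hτmul, hτ0, -⟩ := exists_matrix_model (V := V) hφ2 hμ hμ0
  -- `τ` is injective on `𝔥 ⊗ ℂ`
  have hinj : ∀ Z ∈ spanC H.hodgeLie, τ Z = 0 → Z = 0 := fun Z hZ h0 =>
    UnitaryTheta.eq_zero_of_forall_mem_eigenspace H ψ hφE hd hφ2 hE hμ (hZφ Z hZ)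
      (ThetaSubalgebra.formBaseChange_add_eq_zero_of_mem_spanC ψ hskew hZ) (hτ0 Z (hZW Z hZ) h0)
  have h𝔡C : spanC 𝔡 ≤ spanC H.hodgeLie := spanC_mono h𝔡𝔥
  have hfin : ∀ 𝔞 : Submodule ℚ (Module.End ℚ V), 𝔞 ≤ H.hodgeLie → finrank ℂ ↥((spanC 𝔞).map τ) = finrank ℚ ↥𝔞 := by
    intro 𝔞 h𝔞
    have hi : Function.Injective (τ.domRestrict (spanC 𝔞)) := by
      intro x y hxy
      apply Subtype.ext
      rw [← sub_eq_zero]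
      refine hinj _ (spanC_mono h𝔞 (Submodule.sub_mem _ x.2 y.2)) ?_
      rw [map_sub, sub_eq_zero]
      exact hxy
    rw [← LinearMap.range_domRestrict, LinearMap.finrank_range_of_inj hi, finrank_spanC_eq]
  -- `τ(𝔡 ⊗ ℂ)` is traceless
  have htr : ∀ Z ∈ spanC 𝔡, Matrix.trace (τ Z) = 0 := by
    intro Z hZ
    induction hZ using Submodule.span_induction with
    | mem Z hZ =>
      obtain ⟨B, hB, rfl⟩ := hZ
      dsimp only
      induction hB using Submodule.span_induction with
      | mem B hB =>
        obtain ⟨X, hX, Y, hY, rfl⟩ := hB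
        rw [LinearMap.baseChange_sub, LinearMap.baseChange_mul, LinearMap.baseChange_mul, map_sub,
          hτmul _ _ (hZW _ (baseChange_mem_spanC hY)), hτmul _ _ (hZW _ (baseChange_mem_spanC hX)), Matrix.trace_sub,
          Matrix.trace_mul_comm, sub_self]
      | zero => rw [LinearMap.baseChange_zero, map_zero, Matrix.trace_zero]
      | add B₁ B₂ _ _ h₁ h₂ => rw [LinearMap.baseChange_add, map_add, Matrix.trace_add, h₁, h₂, add_zero]
      | smul c B _ h => rw [hq, map_smul, Matrix.trace_smul, h, smul_zero]
    | zero => rw [map_zero, Matrix.trace_zero]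
    | add Z₁ Z₂ _ _ h₁ h₂ => rw [map_add, Matrix.trace_add, h₁, h₂, add_zero]
    | smul c Z _ h => rw [map_smul, Matrix.trace_smul, h, smul_zero]
  -- the matrix Lie algebra `𝔰𝔩_m(ℂ)` and `τ(𝔡 ⊗ ℂ) = 𝔰𝔩_m(ℂ)`
  letI : LieRing (Matrix (Fin m) (Fin m) ℂ) := LieRing.ofAssociativeRing
  letI : LieAlgebra ℂ (Matrix (Fin m) (Fin m) ℂ) := LieAlgebra.ofAssociativeAlgebra
  have hmemsl : ∀ N : Matrix (Fin m) (Fin m) ℂ, N ∈ (LieAlgebra.SpecialLinear.sl (Fin m) ℂ).toSubmodule ↔ Matrix.trace N = 0 :=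
    fun N => Iff.rfl
  have hsl_fin : finrank ℂ ↥(LieAlgebra.SpecialLinear.sl (Fin m) ℂ).toSubmodule = m ^ 2 - 1 := by
    have h1 : (LieAlgebra.SpecialLinear.sl (Fin m) ℂ).toSubmodule = LinearMap.ker (Matrix.traceLinearMap (Fin m) ℂ ℂ) := rfl
    haveI : Nonempty (Fin m) := ⟨⟨0, by omega⟩⟩
    have hsurj : Function.Surjective (Matrix.traceLinearMap (Fin m) ℂ ℂ) := Matrix.trace_surjective
    have h2 := LinearMap.finrank_range_add_finrank_ker (Matrix.traceLinearMap (Fin m) ℂ ℂ)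
    rw [LinearMap.range_eq_top.2 hsurj, finrank_top, Module.finrank_self, Module.finrank_matrix, Module.finrank_self, Fintype.card_fin,
      mul_one] at h2
    rw [h1, sq]
    omega
  have hS : (spanC 𝔡).map τ = (LieAlgebra.SpecialLinear.sl (Fin m) ℂ).toSubmodule := by
    apply Submodule.eq_of_le_of_finrank_eq
    · rintro _ ⟨Z, hZ, rfl⟩
      exact (hmemsl _).2 (htr Z hZ)
    · rw [hfin 𝔡 h𝔡𝔥, hsl_fin]
      have e : finrank ℚ ↥𝔡 = finrank ℚ ↥(Submodule.span ℚ {B | ∃ X ∈ H.hodgeLie, ∃ Y ∈ H.hodgeLie, X * Y - Y * X = B}) := rfl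
      omega
  -- brackets of images: `[τ(𝔡_ℂ), τ(𝔞_ℂ)] ⊆ τ(𝔠_ℂ)` when `[𝔡, 𝔞] ⊆ 𝔠`
  have hbracket : ∀ 𝔞 𝔠 : Submodule ℚ (Module.End ℚ V), 𝔞 ≤ H.hodgeLie → (∀ X ∈ 𝔡, ∀ Z ∈ 𝔞, X * Z - Z * X ∈ 𝔠) →
      ∀ Y ∈ (spanC 𝔡).map τ, ∀ w ∈ (spanC 𝔞).map τ, Y * w - w * Y ∈ (spanC 𝔠).map τ := by
    intro 𝔞 𝔠 h𝔞 hst Y hY w hw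
    let f : Matrix (Fin m) (Fin m) ℂ →ₗ[ℂ] Matrix (Fin m) (Fin m) ℂ →ₗ[ℂ] Matrix (Fin m) (Fin m) ℂ :=
      LinearMap.mul ℂ (Matrix (Fin m) (Fin m) ℂ) - (LinearMap.mul ℂ (Matrix (Fin m) (Fin m) ℂ)).flip
    have hf : ∀ a b, f a b = a * b - b * a := fun a b => rfl
    have hY' : Y ∈ Submodule.span ℂ (τ '' ((fun X : Module.End ℚ V => X.baseChange ℂ) '' (𝔡 : Set (Module.End ℚ V)))) := by
      rw [← Submodule.map_span]; exact hY
    have hw' : w ∈ Submodule.span ℂ (τ '' ((fun X : Module.End ℚ V => X.baseChange ℂ) '' (𝔞 : Set (Module.End ℚ V)))) := by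
      rw [← Submodule.map_span]; exact hw
    have h := Submodule.apply_mem_map₂ f hY' hw'
    rw [Submodule.map₂_span_span] at h
    refine (Submodule.span_le.2 ?_) h
    rintro _ ⟨_, ⟨_, ⟨X, hX, rfl⟩, rfl⟩, _, ⟨_, ⟨Z, hZ, rfl⟩, rfl⟩, rfl⟩
    dsimp only
    rw [SetLike.mem_coe, hf, ← hτmul _ _ (hZW _ (spanC_mono h𝔞 (baseChange_mem_spanC hZ))),
      ← hτmul _ _ (hZW _ (h𝔡C (baseChange_mem_spanC hX))), ← map_sub, ← LinearMap.baseChange_mul, ← LinearMap.baseChange_mul,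
      ← LinearMap.baseChange_sub]
    exact Submodule.mem_map_of_mem (baseChange_mem_spanC (hst X hX Z hZ))
  have hcard : 1 < Fintype.card (Fin m) := by rw [Fintype.card_fin]; omega
  have hcard0 : (Fintype.card (Fin m) : ℂ) ≠ 0 := by rw [Fintype.card_fin]; exact Nat.cast_ne_zero.2 (by omega)
  refine ⟨fun I => ?_, fun hab => ?_⟩
  · -- (1) a Lie ideal `I` of `𝔡`
    set I' : Submodule ℚ (Module.End ℚ V) := (I : Submodule ℚ 𝔏).map 𝔏.toSubmodule.subtype with hI'def
    have hI'le : I' ≤ 𝔡 := by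
      rintro _ ⟨z, -, rfl⟩
      rw [← h𝔏]
      exact z.2
    have hst : ∀ X ∈ 𝔡, ∀ Z ∈ I', X * Z - Z * X ∈ I' := by
      rintro X hX _ ⟨z, hz, rfl⟩
      have hX𝔏 : X ∈ 𝔏 := by rw [← LieSubalgebra.mem_toSubmodule, h𝔏]; exact hX
      refine ⟨⁅(⟨X, hX𝔏⟩ : 𝔏), z⁆, I.lie_mem hz, ?_⟩
      rw [Submodule.coe_subtype, LieSubalgebra.coe_bracket, Ring.lie_def]
    have hideal := hbracket I' I' (hI'le.trans h𝔡𝔥) hst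
    let J : LieIdeal ℂ (LieAlgebra.SpecialLinear.sl (Fin m) ℂ) :=
      { ((spanC I').map τ).comap (LieAlgebra.SpecialLinear.sl (Fin m) ℂ).toSubmodule.subtype with
        lie_mem := fun {x y} hy => by
          change ((⁅x, y⁆ : LieAlgebra.SpecialLinear.sl (Fin m) ℂ) : Matrix (Fin m) (Fin m) ℂ) ∈ (spanC I').map τ
          rw [LieSubalgebra.coe_bracket, Ring.lie_def]
          have hx : (x : Matrix (Fin m) (Fin m) ℂ) ∈ (spanC 𝔡).map τ := by rw [hS]; exact x.2
          exact hideal _ hx _ hy }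
    have hJmem : ∀ x : LieAlgebra.SpecialLinear.sl (Fin m) ℂ, x ∈ J ↔ (x : Matrix (Fin m) (Fin m) ℂ) ∈ (spanC I').map τ := fun x => Iff.rfl
    rcases Literature.Algebra.Lie.SpecialLinearSimple.eq_bot_or_eq_top_of_lieIdeal two_ne_zero hcard0 J with hJ | hJ
    · left
      rw [← LieSubmodule.toSubmodule_eq_bot, Submodule.eq_bot_iff]
      intro z hz
      have hzC : (z : Module.End ℚ V).baseChange ℂ ∈ spanC I' := baseChange_mem_spanC ⟨z, hz, rfl⟩
      have hzsl : τ ((z : Module.End ℚ V).baseChange ℂ) ∈ (LieAlgebra.SpecialLinear.sl (Fin m) ℂ).toSubmodule := by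
        rw [← hS]; exact Submodule.mem_map_of_mem (spanC_mono hI'le hzC)
      have hJz : (⟨_, hzsl⟩ : LieAlgebra.SpecialLinear.sl (Fin m) ℂ) ∈ J := (hJmem _).2 (Submodule.mem_map_of_mem hzC)
      rw [hJ, LieSubmodule.mem_bot] at hJz
      have h0 : τ ((z : Module.End ℚ V).baseChange ℂ) = 0 := congrArg Subtype.val hJz
      have hz0 : (z : Module.End ℚ V).baseChange ℂ = 0 := hinj _ (h𝔡C (spanC_mono hI'le hzC)) h0
      have hzbot : (z : Module.End ℚ V) ∈ (⊥ : Submodule ℚ (Module.End ℚ V)) :=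
        (mem_iff_baseChange_mem_spanC ⊥ (z : Module.End ℚ V)).2 (by rw [hz0]; exact Submodule.zero_mem _)
      rw [Submodule.mem_bot] at hzbot
      exact Subtype.ext hzbot
    · right
      have hWI : (spanC I').map τ = (LieAlgebra.SpecialLinear.sl (Fin m) ℂ).toSubmodule := by
        apply le_antisymm
        · rw [← hS]; exact Submodule.map_mono (spanC_mono hI'le)
        · intro x hx
          have h : (⟨x, hx⟩ : LieAlgebra.SpecialLinear.sl (Fin m) ℂ) ∈ J := by rw [hJ]; exact LieSubmodule.mem_top _
          exact (hJmem _).1 h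
      have hfinI : finrank ℚ ↥(I : Submodule ℚ 𝔏) = finrank ℚ 𝔏 := by
        have e1 : finrank ℚ ↥(I : Submodule ℚ 𝔏) = finrank ℚ ↥I' := (Submodule.finrank_map_subtype_eq 𝔏.toSubmodule (I : Submodule ℚ 𝔏)).symm
        have e2 : finrank ℚ 𝔏 = finrank ℚ ↥𝔏.toSubmodule := rfl
        have e3 : finrank ℚ ↥𝔡 = finrank ℚ ↥(Submodule.span ℚ {B | ∃ X ∈ H.hodgeLie, ∃ Y ∈ H.hodgeLie, X * Y - Y * X = B}) := rfl
        rw [e1, e2, h𝔏, ← hfin I' (hI'le.trans h𝔡𝔥), hWI, hsl_fin]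
        omega
      rw [← LieSubmodule.toSubmodule_eq_top]
      exact Submodule.eq_top_of_finrank_eq hfinI
  · -- (2) `𝔡` is not abelian: `𝔰𝔩_m(ℂ)` is not
    have hst : ∀ X ∈ 𝔡, ∀ Z ∈ 𝔡, X * Z - Z * X ∈ (⊥ : Submodule ℚ (Module.End ℚ V)) := by
      intro X hX Z hZ
      have hX𝔏 : X ∈ 𝔏 := by rw [← LieSubalgebra.mem_toSubmodule, h𝔏]; exact hX
      have hZ𝔏 : Z ∈ 𝔏 := by rw [← LieSubalgebra.mem_toSubmodule, h𝔏]; exact hZ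
      have h := hab.trivial (⟨X, hX𝔏⟩ : 𝔏) ⟨Z, hZ𝔏⟩
      have h' := congrArg Subtype.val h
      rw [LieSubalgebra.coe_bracket, Ring.lie_def] at h'
      rw [Submodule.mem_bot]
      exact h'
    have hbot : (spanC (⊥ : Submodule ℚ (Module.End ℚ V))).map τ = ⊥ := by
      rw [Submodule.eq_bot_iff]
      rintro _ ⟨Z, hZ, rfl⟩
      have hZ0 : Z = 0 := by
        have h : spanC (⊥ : Submodule ℚ (Module.End ℚ V)) ≤ ⊥ := by
          unfold spanC
          rw [Submodule.span_le]
          rintro _ ⟨X, hX, rfl⟩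
          rw [SetLike.mem_coe, Submodule.mem_bot] at hX
          dsimp only
          rw [hX, LinearMap.baseChange_zero]
          exact Submodule.zero_mem _
        exact (Submodule.mem_bot ℂ).1 (h hZ)
      rw [hZ0, map_zero]
    have hall := hbracket 𝔡 ⊥ h𝔡𝔥 hst
    rw [hbot, hS] at hall
    refine LieAlgebra.SpecialLinear.sl_non_abelian (Fin m) ℂ hcard ⟨fun x y => Subtype.ext ?_⟩
    rw [LieSubalgebra.coe_bracket, Ring.lie_def, ZeroMemClass.coe_zero]
    exact (Submodule.mem_bot ℂ).1 (hall _ x.2 _ y.2)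

end UnitaryDerived

end Literature.AlgebraicGeometry.HodgeTheory.MumfordTateRank

end
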